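import Mathlib
import HarnessLib

/-!
# E-es-185 STEP 1→2 glue, `E`-free: a homomorphism from a finite abelian group with at most four `2`-torsion elements into a
# group of exponent `2` takes values in a Klein four-set `{1, v₁, v₂, v₁v₂}`
(route `ManinLocalTwoThree`, crux C2 `ManinOddAtFour` stmt-BirchSwinnertonDyer-22967; cell bsd-f2-manin, C2/C3 LEAD p1 gen 19;
`--supports stmt-BirchSwinnertonDyer-22967`; line card `Lines/kummer_diamond.md`: supplies hypothesis `hV` of D6
`KummerDiamondStepTwo.descent_table_of_diamond_classes` — «all classes `δ(R_Q)`, `δ(T₁)`, `δ(T₂)` lie in one four-set», i.e.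
`|δ(E(ℚ)_tors)| ≤ |tors/2·tors| = |tors[2]| ≤ 4` (es §59.5 STEP 1: "`V_tors := δ(T) ≅ T/2T` has order `4`"))

* `exists_fourSet_of_ncard_le_four` — a multiplicatively closed subset `S ∋ 1` of a group of exponent `2` with `|S| ≤ 4` lies in
  `{1, v₁, v₂, v₁v₂}` for some `v₁, v₂`.
* `exists_fourSet_of_card_twoTorsion_le_four` — for a FINITE additive commutative group `T` whose `2`-torsion `{t | 2•t = 0}` has at
  most `4` elements and ANY additive hom `δ : T →+ Additive G` into a group `G` of exponent `2`, all values lie in one four-set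
  (`δ` kills `2T`, `|T/2T| = |T[2]|` by Lagrange + first isomorphism theorem).

Elementary group theory; nothing about C2, Manin's conjecture or BSD is proved here.
-/

set_option autoImplicit false
-- lint-debt: the directory name repeats the summit name (sibling precedent `ManinLocalTwoThreeKummerDiamondDescentStepTwo.lean`)
set_option linter.dupNamespace false

namespace Summit.BirchSwinnertonDyer.BirchSwinnertonDyer.Theorems.ManinLocalTwoThree.KummerDiamondStepTwo

/-! ## §1 Small multiplicatively closed subsets of a group of exponent `2` -/

/-- In a group of exponent `2`, a multiplicatively closed subset containing `1` with at most four elements is contained in a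
Klein four-set `{1, v₁, v₂, v₁v₂}`. [folklore] -/
theorem exists_fourSet_of_ncard_le_four {G : Type*} [CommGroup G] (hG : ∀ g : G, g * g = 1) (S : Set G) (hS : S.Finite)
    (h1 : (1 : G) ∈ S) (hmul : ∀ a ∈ S, ∀ b ∈ S, a * b ∈ S) (hcard : S.ncard ≤ 4) :
    ∃ v₁ v₂ : G, ∀ x ∈ S, x = 1 ∨ x = v₁ ∨ x = v₂ ∨ x = v₁ * v₂ := by
  classical
  by_cases hA : ∃ v₁ ∈ S, v₁ ≠ 1
  · obtain ⟨v₁, hv₁S, hv₁⟩ := hA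
    by_cases hB : ∃ v₂ ∈ S, v₂ ≠ 1 ∧ v₂ ≠ v₁
    · obtain ⟨v₂, hv₂S, hv₂, hv₂₁⟩ := hB
      refine ⟨v₁, v₂, fun x hx => ?_⟩
      by_contra hx4
      simp only [not_or] at hx4
      obtain ⟨hx1, hxv₁, hxv₂, hxv₁₂⟩ := hx4
      -- `v₁ v₂` is a fourth element of `S`, distinct from `1, v₁, v₂`
      have h12S : v₁ * v₂ ∈ S := hmul v₁ hv₁S v₂ hv₂S
      have h12_1 : v₁ * v₂ ≠ 1 := by
        intro h
        apply hv₂₁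
        calc v₂ = v₁ * v₁ * v₂ := by rw [hG, one_mul]
          _ = v₁ * (v₁ * v₂) := by rw [mul_assoc]
          _ = v₁ := by rw [h, mul_one]
      have h12_v₁ : v₁ * v₂ ≠ v₁ := by
        intro h
        apply hv₂
        calc v₂ = v₁ * v₁ * v₂ := by rw [hG, one_mul]
          _ = v₁ * (v₁ * v₂) := by rw [mul_assoc]
          _ = v₁ * v₁ := by rw [h]
          _ = 1 := hG v₁
      have h12_v₂ : v₁ * v₂ ≠ v₂ := by
        intro h
        apply hv₁
        calc v₁ = v₁ * (v₂ * v₂) := by rw [hG, mul_one]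
          _ = v₁ * v₂ * v₂ := by rw [mul_assoc]
          _ = v₂ * v₂ := by rw [h]
          _ = 1 := hG v₂
      -- five distinct elements of `S`
      let F : Finset G := {1, v₁, v₂, v₁ * v₂, x}
      have hFcard : F.card = 5 := by
        simp only [F]
        rw [Finset.card_insert_of_notMem, Finset.card_insert_of_notMem, Finset.card_insert_of_notMem,
          Finset.card_insert_of_notMem, Finset.card_singleton]
        · simp only [Finset.mem_singleton]; exact fun h => hxv₁₂ h.symm
        · simp only [Finset.mem_insert, Finset.mem_singleton, not_or]; exact ⟨fun h => h12_v₂ h.symm, fun h => hxv₂ h.symm⟩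
        · simp only [Finset.mem_insert, Finset.mem_singleton, not_or]
          exact ⟨fun h => hv₂₁ h.symm, fun h => h12_v₁ h.symm, fun h => hxv₁ h.symm⟩
        · simp only [Finset.mem_insert, Finset.mem_singleton, not_or]
          exact ⟨fun h => hv₁ h.symm, fun h => hv₂ h.symm, fun h => h12_1 h.symm, fun h => hx1 h.symm⟩
      have hFS : (F : Set G) ⊆ S := by
        intro y hy
        simp only [F, Finset.coe_insert, Finset.coe_singleton, Set.mem_insert_iff, Set.mem_singleton_iff] at hy
        rcases hy with rfl | rfl | rfl | rfl | rfl
        · exact h1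
        · exact hv₁S
        · exact hv₂S
        · exact h12S
        · exact hx
      have : F.card ≤ S.ncard := by
        rw [← Set.ncard_coe_finset]
        exact Set.ncard_le_ncard hFS hS
      omega
    · -- at most one non-trivial element
      refine ⟨v₁, 1, fun x hx => ?_⟩
      by_cases hx1 : x = 1
      · exact Or.inl hx1
      · by_cases hxv : x = v₁
        · exact Or.inr (Or.inl hxv)
        · exact absurd ⟨x, hx, hx1, hxv⟩ hB
  · refine ⟨1, 1, fun x hx => Or.inl ?_⟩
    by_contra h
    exact hA ⟨x, hx, h⟩

/-! ## §2 `|T/2T| = |T[2]|` and the four-set of values -/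

/-- For a finite additive commutative group `T`, `|T ⧸ 2T| = |T[2]|` (Lagrange + the first isomorphism theorem for `t ↦ 2•t`).
[folklore] -/
theorem card_quotient_two_eq_card_twoTorsion (T : Type*) [AddCommGroup T] [Finite T] :
    Nat.card (T ⧸ (nsmulAddMonoidHom 2 : T →+ T).range) = Nat.card (nsmulAddMonoidHom 2 : T →+ T).ker := by
  set f : T →+ T := nsmulAddMonoidHom 2 with hf
  have h1 : Nat.card T = Nat.card (T ⧸ f.range) * Nat.card f.range :=
    AddSubgroup.card_eq_card_quotient_mul_card_addSubgroup f.range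
  have h2 : Nat.card T = Nat.card (T ⧸ f.ker) * Nat.card f.ker :=
    AddSubgroup.card_eq_card_quotient_mul_card_addSubgroup f.ker
  have h3 : Nat.card (T ⧸ f.ker) = Nat.card f.range := Nat.card_congr (QuotientAddGroup.quotientKerEquivRange f).toEquiv
  have hpos : 0 < Nat.card f.range := Nat.card_pos
  rw [h3] at h2
  rw [h2] at h1
  -- `h1 : card range * card ker = card quot * card range`
  exact Nat.eq_of_mul_eq_mul_right hpos (by linarith [h1, mul_comm (Nat.card f.range) (Nat.card f.ker)])

/-- **Values of a hom into a group of exponent `2` lie in a four-set** when the source is a finite additive commutative group with at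
most four `2`-torsion elements: `δ` kills `2T` (as `δ(2t) = δ(t)² = 1`), so it factors through `T/2T`, of order `|T[2]| ≤ 4`, and its
image is a multiplicatively closed set with `≤ 4` elements (`exists_fourSet_of_ncard_le_four`).  This is es §59.5 STEP 1's
"`V_tors = δ(T)` has order `4`" in the form consumed by `descent_table_of_diamond_classes` (`hV`, `ht₁`, `ht₂`).
[cite: SilvermanAEC2009, Prop. X.1.4] -/
theorem exists_fourSet_of_card_twoTorsion_le_four {T : Type*} [AddCommGroup T] [Finite T]
    (h4 : Nat.card (nsmulAddMonoidHom 2 : T →+ T).ker ≤ 4)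
    {G : Type*} [CommGroup G] (hG : ∀ g : G, g * g = 1) (δ : T →+ Additive G) :
    ∃ v₁ v₂ : G, ∀ t : T, Additive.toMul (δ t) = 1 ∨ Additive.toMul (δ t) = v₁ ∨ Additive.toMul (δ t) = v₂ ∨
      Additive.toMul (δ t) = v₁ * v₂ := by
  classical
  set f : T →+ T := nsmulAddMonoidHom 2 with hf
  -- `δ` kills `2T`
  have hker : f.range ≤ δ.ker := by
    rintro _ ⟨t, rfl⟩
    rw [AddMonoidHom.mem_ker, hf, nsmulAddMonoidHom_apply, map_nsmul]
    change Additive.ofMul ((Additive.toMul (δ t)) ^ 2) = Additive.ofMul 1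
    rw [pow_two, hG]
  set δ' : T ⧸ f.range →+ Additive G := QuotientAddGroup.lift f.range δ hker with hδ'
  have hδ'mk : ∀ t : T, δ' (t : T ⧸ f.range) = δ t := fun t => QuotientAddGroup.lift_mk f.range hker t
  -- the image
  set S : Set G := Set.range (fun t : T => Additive.toMul (δ t)) with hS
  have hSeq : S = Set.range (fun u : T ⧸ f.range => Additive.toMul (δ' u)) := by
    ext g
    simp only [hS, Set.mem_range]
    constructor
    · rintro ⟨t, rfl⟩; exact ⟨t, by rw [hδ'mk]⟩
    · rintro ⟨u, rfl⟩
      induction u using QuotientAddGroup.induction_on with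
      | H t => exact ⟨t, by rw [hδ'mk]⟩
  haveI : Finite (T ⧸ f.range) := Finite.of_surjective _ QuotientAddGroup.mk_surjective
  have hcard : S.ncard ≤ 4 := by
    rw [← Nat.card_coe_set_eq, hSeq]
    calc Nat.card (Set.range fun u : T ⧸ f.range => Additive.toMul (δ' u)) ≤ Nat.card (T ⧸ f.range) := Finite.card_range_le _
      _ = Nat.card f.ker := card_quotient_two_eq_card_twoTorsion T
      _ ≤ 4 := h4
  have hfin : S.Finite := Set.finite_range _
  have h1 : (1 : G) ∈ S := ⟨0, by simp⟩
  have hmul : ∀ a ∈ S, ∀ b ∈ S, a * b ∈ S := by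
    rintro _ ⟨s, rfl⟩ _ ⟨t, rfl⟩
    exact ⟨s + t, by simp only [map_add, toMul_add]⟩
  obtain ⟨v₁, v₂, hV⟩ := exists_fourSet_of_ncard_le_four hG S hfin h1 hmul hcard
  exact ⟨v₁, v₂, fun t => hV _ ⟨t, rfl⟩⟩

/-- The `2`-torsion kernel `ker (t ↦ 2•t)` is the subtype `{t // 2 • t = 0}` (for rewriting the cardinality hypothesis).
[folklore] -/
theorem card_ker_two_eq (T : Type*) [AddCommGroup T] :
    Nat.card (nsmulAddMonoidHom 2 : T →+ T).ker = Nat.card {t : T // 2 • t = 0} :=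
  Nat.card_congr (Equiv.subtypeEquivRight fun t => by rw [AddMonoidHom.mem_ker, nsmulAddMonoidHom_apply])

end Summit.BirchSwinnertonDyer.BirchSwinnertonDyer.Theorems.ManinLocalTwoThree.KummerDiamondStepTwo
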